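import Literature.Analysis.FluidPDE.TaoUnitViscosity
import Literature.Analysis.UnboundedOperators.HeatKernelLpSmoothingProofs
import Mathlib.Analysis.SpecialFunctions.Integrals.Basic
import HarnessLib

/-!
# Tao (2011/2013), Prop. 9.1 (bounded total speed): the a priori form, the proved linear
# (dispersive) part, and the nonlinear Duhamel component as a named fact

Decomposition of the leaf `NS.tao2011_boundedTotalSpeed_unit` (Tao 2011, Prop. 9.1 = arXiv
Prop. 52, `ν = 1`, `f = 0`) of the Cor. 11.4 chain along its printed proof (arXiv:1108.1165,
§9, pp. 27–28). The proof has three ingredients: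

1. the energy-class bounds (9.4)–(9.6), `‖u‖_{L^∞_t L²_x} ≲ E₀^{1/2}`, `‖∇u‖_{L²_t L²_x} ≲ E₀^{1/2}`,
   taken "from (8.2)", i.e. from Lemma 8.1 (the tree's named fact
   `NS.tao_finite_energy_smooth_energy_bound`);
2. the *linear* part of the Duhamel formula (9.2): "For the free term `e^{tΔ}u₀`, one has by [the
   dispersive inequality of §2, arXiv p. 10] `‖e^{tΔ}u₀‖_{L^∞_x} ≲ t^{-3/4}‖u₀‖_{L²_x}` for
   `t ∈ [0,T]`, so this contribution to (9.1) is acceptable" — **proved** here (`NS.lintegral_eLpNorm_heatExtension_le`) from the tree's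
   `L^p → L^q` smoothing theorem `Literature.Analysis.UnboundedOperators.eLpNorm_heatExtension_le_rpow_holds` (`p = 2`, `q = ∞`,
   `n = 3`) and `∫₀ᵀ t^{-3/4} dt = 4T^{1/4}`;
3. the *nonlinear* part: "It remains to show that
   `‖∫₀ᵗ e^{(t−t')Δ} O(P∇(uu)(t')) dt'‖_{L¹_t L^∞_x} ≲ E₀`" (Littlewood–Paley decomposition, the
   frequency-localised heat decay of Lemma 2.1 = arXiv Lemma 24, Bernstein, paraproduct
   trichotomy, Schur's test; pp. 27–28), applied to the Duhamel formula (9.2), which holds for finite energy almost smooth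
   solutions by Lemma 4.1 (i) / Cor. 4.3 — vendored here as the named fact
   `NS.tao2011_duhamelNonlinearSpeed_unit`, stated on the solution itself: the non-free component
   `u(t) − e^{tΔ}u(0)` (which *is* the Duhamel integral by (9.2)) has total speed `≤ K E` under the
   a priori bounds (9.4)–(9.5). Neither the Littlewood–Paley argument nor the Duhamel formula for
   Tao's solution class is reproduced.

Accordingly (mirroring the treatment of Thm. 10.1 in `TaoEnstrophyLocalisationParts.lean`):

* `NS.tao2011_boundedTotalSpeed_apriori_unit` — Prop. 9.1 with (9.4)–(9.5) as hypotheses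
  (`sup_t ∫|u(t)|² ≤ 2E`, `∫₀ᵀ∫|∇u|² ≤ E` ⇒ `∫₀ᵀ‖u‖_{L^∞} ≤ K(E^{1/2}T^{1/4} + E)`), **proved** from
  the fact in 3. (`…_of_duhamel`), and shown *equivalent* to the printed leaf given Lemma 8.1
  (`NS.tao2011_boundedTotalSpeed_unit_of_apriori`, `…_apriori_unit_of_unit`: the split loses
  nothing);
* assemblies: Cor. 11.1 / Cor. 11.4 from Lemma 8.1, the Duhamel-nonlinear fact and the §10 a
  priori leaf (`NS.tao_unconditional_uniqueness_of_duhamel_leaves`).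

## Mathlib / tree search

Tree: `Literature.Analysis.UnboundedOperators.heatExtension` (`UnboundedOperators/HeatKernel.lean`, `e^{tΔ}f = heatKernel t ⋆ f` for
vector-valued `f`), `Literature.Analysis.UnboundedOperators.eLpNorm_heatExtension_le_rpow_holds` and `Literature.Analysis.UnboundedOperators.memLp_heatExtension_holds`
(proved); no prior a priori / Duhamel form of Prop. 9.1 (`lean search 'boundedTotalSpeed|duhamel'`:
only `tao2011_boundedTotalSpeed(_unit)` and the `L²` duality-form Duhamel facts of
`MildSolution.lean`, which require bounded `u` and are not used here). Mathlib: `integral_rpow`,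
`intervalIntegral.intervalIntegrable_rpow'`, `eLpNorm_add_le`,
`eLpNorm_eq_lintegral_rpow_enorm_toReal`, `finrank_euclideanSpace_fin`.

## References

* T. Tao, *Localisation and compactness properties of the Navier–Stokes global regularity
  problem*, Anal. PDE 6 (2013) 25–107 = arXiv:1108.1165 (`Tao2011`): Prop. 9.1 and its proof
  (arXiv Prop. 52, §9, pp. 27–28: (9.1)–(9.7)), Lemma 4.1 (i) and Cor. 4.3 (arXiv Lemma 25,
  Cor. 27, pp. 14–15), Lemma 8.1 (arXiv Lemma 44), the dispersive inequality and its
  frequency-localised variant (§2, arXiv p. 10, Lemma 24).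
-/

noncomputable section

open MeasureTheory Set Function Filter Topology
open scoped ENNReal NNReal

namespace Literature.Analysis.FluidPDE

/-- Local notation for physical space `ℝ³ = EuclideanSpace ℝ (Fin 3)`. -/
local notation "ℝ³" => EuclideanSpace ℝ (Fin 3)

/-! ## The statements -/

/-- **Tao 2011, Prop. 9.1 (Bounded total speed), a priori form, unit viscosity** (arXiv Prop. 52,
p. 27, `ν = 1`, `f = 0`): the statement the printed proof (§9, pp. 27–28) establishes once its
energy-class inputs (9.4) `‖u‖_{L^∞_t L²_x} ≲ E₀^{1/2}` and (9.5) `‖∇u‖_{L²_t L²_x} ≲ E₀^{1/2}`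
(taken there from Lemma 8.1) are made hypotheses, in the dictionary of the other a priori leaves
(`tao2011_enstrophyLocalisation_exterior_apriori_unit`): `sup_{t ∈ [0,T]} ∫|u(t)|² ≤ 2E` and
`∫₀ᵀ∫|∇u|²_F ≤ E` (the factor `ENNReal.ofReal 1` keeps the hypothesis literally that of the §10
leaves) imply `∫₀ᵀ ‖u(t)‖_{L^∞} dt ≤ K(E^{1/2}T^{1/4} + E)` ((9.6) `‖u₀‖_{L²} ≲ E₀^{1/2}` is the
case `t = 0` of the first hypothesis). Equivalent, given Lemma 8.1, to the printed leaf
`tao2011_boundedTotalSpeed_unit` (`tao2011_boundedTotalSpeed_unit_of_apriori`,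
`tao2011_boundedTotalSpeed_apriori_unit_of_unit`); proved below from the Duhamel-nonlinear fact
`tao2011_duhamelNonlinearSpeed_unit` and the dispersive estimate. [cite: Tao2011, Prop. 9.1 (proof, §9)] -/
def tao2011_boundedTotalSpeed_apriori_unit : Prop :=
  ∃ K : ℝ, 0 < K ∧
    ∀ ⦃T : ℝ⦄ (_hT : 0 < T) ⦃u : ℝ → ℝ³ → ℝ³⦄ ⦃p : ℝ → ℝ³ → ℝ⦄
      (_hsol : FluidPDE.IsClassicalNSSolutionOn (Icc 0 T) 1 0 u p)
      ⦃E : ℝ⦄ (_hE : 0 ≤ E)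
      (_hEt : ∀ t ∈ Icc 0 T, ∫⁻ x, ‖u t x‖ₑ ^ 2 ≤ ENNReal.ofReal (2 * E))
      (_hD : ENNReal.ofReal 1 *
          ∫⁻ t in Ioo 0 T, ∫⁻ x, ENNReal.ofReal (FluidPDE.frobeniusNormSq (fderiv ℝ (u t) x)) ≤
        ENNReal.ofReal E),
      ∫⁻ t in Ioo 0 T, eLpNorm (u t) ∞ volume ≤
        ENNReal.ofReal (K * (Real.sqrt E * T ^ (1 / 4 : ℝ) + E))

/-- **Tao 2011, proof of Prop. 9.1: total speed of the nonlinear Duhamel component** (arXiv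
pp. 27–28, `ν = 1`, `f = 0`). For a finite energy almost smooth solution the Duhamel formula
(9.2), `u(t) = e^{tΔ}u₀ + ∫₀ᵗ e^{(t−t')Δ}(P O(∇(uu)))(t') dt'`, holds (projected equation (9.1),
via Cor. 4.3 / Lemma 4.1 (i), pressure normalisation), and "It remains to show that
`‖∫₀ᵗ e^{(t−t')Δ} O(P∇(uu)(t')) dt'‖_{L¹_t L^∞_x([0,T] × ℝ³)} ≲ E₀`", which Tao proves from (9.5)
alone by Littlewood–Paley decomposition, the frequency-localised heat decay (arXiv Lemma 24),
Bernstein's inequality, the paraproduct trichotomy and Schur's test ((9.7) and the display after it: the bound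
is `≲ ∑_N a_N² ≲ E₀`, `a_N = ‖∇u_N‖_{L²_t L²_x}`). Vendored on the solution itself, in a priori
form: for a classical solution of the `ν = 1`, `f = 0` system on the closed slab `[0, T] × ℝ³`
with `sup_t ∫|u(t)|² ≤ 2E` (finite energy, the hypothesis of Lemma 4.1 (i)) and `∫₀ᵀ∫|∇u|²_F ≤ E`
((9.5)), the non-free component `u(t) − e^{tΔ}u(0)` — `e^{tΔ} = Literature.heatExtension`, the
Gauss–Weierstrass convolution — satisfies `∫₀ᵀ ‖u(t) − e^{tΔ}u(0)‖_{L^∞} dt ≤ K E` with an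
absolute constant `K`. Neither the Duhamel formula for this solution class nor the
Littlewood–Paley argument is reproduced. [cite: Tao2011, Prop. 9.1 (proof, §9, (9.2) and (9.7)) + Lemma 4.1 (i)] -/
def tao2011_duhamelNonlinearSpeed_unit : Prop :=
  ∃ K : ℝ, 0 < K ∧
    ∀ ⦃T : ℝ⦄ (_hT : 0 < T) ⦃u : ℝ → ℝ³ → ℝ³⦄ ⦃p : ℝ → ℝ³ → ℝ⦄
      (_hsol : FluidPDE.IsClassicalNSSolutionOn (Icc 0 T) 1 0 u p)
      ⦃E : ℝ⦄ (_hE : 0 ≤ E)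
      (_hEt : ∀ t ∈ Icc 0 T, ∫⁻ x, ‖u t x‖ₑ ^ 2 ≤ ENNReal.ofReal (2 * E))
      (_hD : ENNReal.ofReal 1 *
          ∫⁻ t in Ioo 0 T, ∫⁻ x, ENNReal.ofReal (FluidPDE.frobeniusNormSq (fderiv ℝ (u t) x)) ≤
        ENNReal.ofReal E),
      ∫⁻ t in Ioo 0 T, eLpNorm (fun x => u t x - UnboundedOperators.heatExtension (u 0) t x) ∞ volume ≤
        ENNReal.ofReal (K * E)

/-! ## The linear part: the dispersive estimate, integrated in time (proved) -/

/-- The `L²` norm from the energy hypothesis: `∫ |v|² ≤ 2E` gives `‖v‖_{L²} ≤ (2E)^{1/2}`. [folklore] -/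
theorem eLpNorm_two_le_sqrt {v : ℝ³ → ℝ³} {E : ℝ} (hE : 0 ≤ E)
    (h : ∫⁻ x, ‖v x‖ₑ ^ 2 ≤ ENNReal.ofReal (2 * E)) :
    eLpNorm v 2 volume ≤ ENNReal.ofReal (Real.sqrt (2 * E)) := by
  rw [eLpNorm_eq_lintegral_rpow_enorm_toReal two_ne_zero ENNReal.ofNat_ne_top]
  have h2 : (2 : ℝ≥0∞).toReal = 2 := by norm_num
  rw [h2]
  have h' : ∫⁻ x, ‖v x‖ₑ ^ (2 : ℝ) ≤ ENNReal.ofReal (2 * E) := by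
    simpa only [ENNReal.rpow_two] using h
  calc (∫⁻ x, ‖v x‖ₑ ^ (2 : ℝ)) ^ (1 / (2 : ℝ)) ≤ (ENNReal.ofReal (2 * E)) ^ (1 / (2 : ℝ)) :=
        ENNReal.rpow_le_rpow h' (by norm_num)
    _ = ENNReal.ofReal (Real.sqrt (2 * E)) := by
        rw [ENNReal.ofReal_rpow_of_nonneg (by positivity) (by norm_num), Real.sqrt_eq_rpow]

/-- A continuous slice with `∫ |v|² ≤ 2E` is in `L²`. [folklore] -/
theorem memLp_two_of_lintegral_le {v : ℝ³ → ℝ³} (hv : Continuous v) {E : ℝ}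
    (h : ∫⁻ x, ‖v x‖ₑ ^ 2 ≤ ENNReal.ofReal (2 * E)) : MemLp v 2 volume := by
  refine (memLp_two_iff_integrable_sq_norm hv.aestronglyMeasurable).2 ⟨(hv.norm.pow 2).aestronglyMeasurable, ?_⟩
  refine (hasFiniteIntegral_iff_enorm).2 (lt_of_le_of_lt (le_of_eq ?_) (h.trans_lt ENNReal.ofReal_lt_top))
  refine lintegral_congr fun x => ?_
  rw [Real.enorm_eq_ofReal (sq_nonneg _), ← ofReal_norm, ENNReal.ofReal_pow (norm_nonneg _)]

/-- **The dispersive inequality on `ℝ³`** (Tao 2011, §2, arXiv p. 10, case `p = 2`, `q = ∞`,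
`s = k = 0`): `‖e^{tΔ}v‖_{L^∞} ≤ C t^{-3/4}‖v‖_{L²}` for `0 < t`, with an absolute constant `C`
(the tree's `L^p → L^q` smoothing theorem `Literature.Analysis.UnboundedOperators.eLpNorm_heatExtension_le_rpow_holds` with `p = 2`,
`q = ∞`, `n = 3`). [cite: Tao2011, §2 (dispersive inequality)] -/
theorem exists_eLpNorm_top_heatExtension_le :
    ∃ C : ℝ≥0, ∀ (v : ℝ³ → ℝ³), MemLp v 2 volume → ∀ t : ℝ, 0 < t →
      eLpNorm (UnboundedOperators.heatExtension v t) ∞ volume ≤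
        C * ENNReal.ofReal (t ^ (-(3 / 4 : ℝ))) * eLpNorm v 2 volume := by
  obtain ⟨C, hC⟩ := UnboundedOperators.eLpNorm_heatExtension_le_rpow_holds ℝ³ ℝ³ (p := 2) (q := ∞)
    (by norm_num) le_top
  refine ⟨C, fun v hv t ht => ?_⟩
  have h := hC v hv t ht
  have hexp : -((Module.finrank ℝ ℝ³ : ℝ) / 2) *
      ((1 / (2 : ℝ≥0∞)).toReal - (1 / (∞ : ℝ≥0∞)).toReal) = -(3 / 4 : ℝ) := by
    rw [finrank_euclideanSpace_fin]
    norm_num [ENNReal.toReal_div]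
  rw [hexp] at h
  exact h

/-- `∫₀ᵀ t^{-3/4} dt = 4T^{1/4}` as a lower Lebesgue integral. [folklore] -/
theorem lintegral_rpow_neg_three_quarters {T : ℝ} (hT : 0 < T) :
    ∫⁻ t in Ioo 0 T, ENNReal.ofReal (t ^ (-(3 / 4 : ℝ))) = ENNReal.ofReal (4 * T ^ (1 / 4 : ℝ)) := by
  have hr : (-1 : ℝ) < -(3 / 4 : ℝ) := by norm_num
  have hii : IntervalIntegrable (fun t : ℝ => t ^ (-(3 / 4 : ℝ))) volume 0 T :=
    intervalIntegral.intervalIntegrable_rpow' hr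
  have hint : IntegrableOn (fun t : ℝ => t ^ (-(3 / 4 : ℝ))) (Ioo 0 T) :=
    (hii.1).mono_set Ioo_subset_Ioc_self
  have hnn : 0 ≤ᵐ[volume.restrict (Ioo 0 T)] fun t : ℝ => t ^ (-(3 / 4 : ℝ)) :=
    (ae_restrict_mem measurableSet_Ioo).mono fun t ht => Real.rpow_nonneg ht.1.le _
  rw [← ofReal_integral_eq_lintegral_ofReal hint hnn, ← integral_Ioc_eq_integral_Ioo,
    ← intervalIntegral.integral_of_le hT.le, integral_rpow (Or.inl hr)]
  congr 1
  rw [Real.zero_rpow (by norm_num), sub_zero]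
  norm_num
  ring

/-- The time integral of the dispersive majorant: `∫₀ᵀ A (2E)^{1/2} t^{-3/4} dt = A · 4T^{1/4} (2E)^{1/2}`
in `ℝ≥0∞`. [folklore] -/
theorem lintegral_dispersive_majorant (C : ℝ≥0) (E : ℝ) {T : ℝ} (hT : 0 < T) :
    ∫⁻ t in Ioo 0 T, (C * ENNReal.ofReal (Real.sqrt (2 * E))) * ENNReal.ofReal (t ^ (-(3 / 4 : ℝ))) =
      ENNReal.ofReal ((C : ℝ) * (4 * T ^ (1 / 4 : ℝ)) * Real.sqrt (2 * E)) := by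
  rw [lintegral_const_mul' _ _ (ENNReal.mul_ne_top ENNReal.coe_ne_top ENNReal.ofReal_ne_top),
    lintegral_rpow_neg_three_quarters hT, ← ENNReal.ofReal_coe_nnreal,
    ← ENNReal.ofReal_mul (NNReal.coe_nonneg _), ← ENNReal.ofReal_mul (by positivity)]
  congr 1
  ring

/-- The dispersive majorant is measurable in time. [folklore] -/
theorem measurable_dispersive_majorant (A : ℝ≥0∞) :
    Measurable fun t : ℝ => A * ENNReal.ofReal (t ^ (-(3 / 4 : ℝ))) :=
  ((measurable_id.pow_const _).ennreal_ofReal).const_mul _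

/-- **The free term of (9.2) has acceptable total speed** ("this contribution to (9.1) is
acceptable by (9.6)"): for continuous `v` with `∫|v|² ≤ 2E`,
`∫₀ᵀ ‖e^{tΔ}v‖_{L^∞} dt ≤ C · 4T^{1/4} (2E)^{1/2}`. PROVED. [cite: Tao2011, Prop. 9.1 (proof, §9, free term)] -/
theorem lintegral_eLpNorm_heatExtension_le {C : ℝ≥0}
    (hC : ∀ (v : ℝ³ → ℝ³), MemLp v 2 volume → ∀ t : ℝ, 0 < t →
      eLpNorm (UnboundedOperators.heatExtension v t) ∞ volume ≤ C * ENNReal.ofReal (t ^ (-(3 / 4 : ℝ))) * eLpNorm v 2 volume)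
    {v : ℝ³ → ℝ³} (hv : Continuous v) {E : ℝ} (hE : 0 ≤ E)
    (hvE : ∫⁻ x, ‖v x‖ₑ ^ 2 ≤ ENNReal.ofReal (2 * E)) {T : ℝ} (hT : 0 < T) :
    ∫⁻ t in Ioo 0 T, eLpNorm (UnboundedOperators.heatExtension v t) ∞ volume ≤
      ENNReal.ofReal ((C : ℝ) * (4 * T ^ (1 / 4 : ℝ)) * Real.sqrt (2 * E)) := by
  have hv2 := memLp_two_of_lintegral_le hv hvE
  have hvn := eLpNorm_two_le_sqrt hE hvE
  rw [← lintegral_dispersive_majorant C E hT]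
  refine lintegral_mono_ae ((ae_restrict_mem measurableSet_Ioo).mono fun t ht => ?_)
  calc eLpNorm (UnboundedOperators.heatExtension v t) ∞ volume
      ≤ C * ENNReal.ofReal (t ^ (-(3 / 4 : ℝ))) * eLpNorm v 2 volume := hC v hv2 t ht.1
    _ ≤ C * ENNReal.ofReal (t ^ (-(3 / 4 : ℝ))) * ENNReal.ofReal (Real.sqrt (2 * E)) :=
        mul_le_mul_right hvn _
    _ = (C * ENNReal.ofReal (Real.sqrt (2 * E))) * ENNReal.ofReal (t ^ (-(3 / 4 : ℝ))) := by ring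

/-! ## Prop. 9.1 (a priori form) from the Duhamel-nonlinear fact -/

/-- **Prop. 9.1, a priori form, from the nonlinear Duhamel fact and the dispersive estimate**:
`‖u(t)‖_{L^∞} ≤ ‖e^{tΔ}u(0)‖_{L^∞} + ‖u(t) − e^{tΔ}u(0)‖_{L^∞}`, the first integrating to
`≤ 4C(2E)^{1/2}T^{1/4}` (`lintegral_eLpNorm_heatExtension_le`, (9.6) being `t = 0` of the energy
hypothesis) and the second to `≤ KE` (the fact); so the a priori Prop. 9.1 holds with constant
`K + 6C`. PROVED. [cite: Tao2011, Prop. 9.1 (proof, §9)] -/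
theorem tao2011_boundedTotalSpeed_apriori_unit_of_duhamel (h : tao2011_duhamelNonlinearSpeed_unit) :
    tao2011_boundedTotalSpeed_apriori_unit := by
  obtain ⟨K, hK, hN⟩ := h
  obtain ⟨C, hC⟩ := exists_eLpNorm_top_heatExtension_le
  refine ⟨K + 6 * C, by positivity, ?_⟩
  intro T hT u p hsol E hE hEt hD
  have h0T : (0 : ℝ) ∈ Icc 0 T := ⟨le_rfl, hT.le⟩
  have hu0 : Continuous (u 0) := (hsol.contDiff_velocity h0T).continuous
  have hu0E := hEt 0 h0T
  have hu02 : MemLp (u 0) 2 volume := memLp_two_of_lintegral_le hu0 hu0E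
  have hvn := eLpNorm_two_le_sqrt hE hu0E
  have hnon := hN hT hsol hE hEt hD
  -- the measurable majorant of the free term and the triangle inequality in `L^∞`
  set A : ℝ → ℝ≥0∞ := fun t => (C * ENNReal.ofReal (Real.sqrt (2 * E))) *
    ENNReal.ofReal (t ^ (-(3 / 4 : ℝ))) with hA
  have hAm : Measurable A := measurable_dispersive_majorant _
  have htri : ∀ t ∈ Ioo 0 T, eLpNorm (u t) ∞ volume ≤
      A t + eLpNorm (fun x => u t x - UnboundedOperators.heatExtension (u 0) t x) ∞ volume := by
    intro t ht
    have hm1 : AEStronglyMeasurable (UnboundedOperators.heatExtension (u 0) t) volume :=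
      (UnboundedOperators.memLp_heatExtension_holds hu02 (by norm_num) ht.1).1
    have hm2 : AEStronglyMeasurable (fun x => u t x - UnboundedOperators.heatExtension (u 0) t x) volume :=
      (hsol.contDiff_velocity (Ioo_subset_Icc_self ht)).continuous.aestronglyMeasurable.sub hm1
    have heq : (UnboundedOperators.heatExtension (u 0) t + fun x => u t x - UnboundedOperators.heatExtension (u 0) t x) = u t := by
      funext x
      simp only [Pi.add_apply, add_sub_cancel]
    have hfree : eLpNorm (UnboundedOperators.heatExtension (u 0) t) ∞ volume ≤ A t := by
      calc eLpNorm (UnboundedOperators.heatExtension (u 0) t) ∞ volume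
          ≤ C * ENNReal.ofReal (t ^ (-(3 / 4 : ℝ))) * eLpNorm (u 0) 2 volume := hC _ hu02 t ht.1
        _ ≤ C * ENNReal.ofReal (t ^ (-(3 / 4 : ℝ))) * ENNReal.ofReal (Real.sqrt (2 * E)) :=
            mul_le_mul_right hvn _
        _ = A t := by rw [hA]; ring
    calc eLpNorm (u t) ∞ volume
        = eLpNorm (UnboundedOperators.heatExtension (u 0) t + fun x => u t x - UnboundedOperators.heatExtension (u 0) t x) ∞ volume := by
          rw [heq]
      _ ≤ eLpNorm (UnboundedOperators.heatExtension (u 0) t) ∞ volume +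
            eLpNorm (fun x => u t x - UnboundedOperators.heatExtension (u 0) t x) ∞ volume := eLpNorm_add_le hm1 hm2 le_top
      _ ≤ A t + eLpNorm (fun x => u t x - UnboundedOperators.heatExtension (u 0) t x) ∞ volume := by
          gcongr
  -- integrate in time
  have hlinA : ∫⁻ t in Ioo 0 T, A t = ENNReal.ofReal ((C : ℝ) * (4 * T ^ (1 / 4 : ℝ)) * Real.sqrt (2 * E)) :=
    lintegral_dispersive_majorant C E hT
  have hsum : ∫⁻ t in Ioo 0 T, eLpNorm (u t) ∞ volume ≤
      ENNReal.ofReal ((C : ℝ) * (4 * T ^ (1 / 4 : ℝ)) * Real.sqrt (2 * E)) + ENNReal.ofReal (K * E) := by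
    calc ∫⁻ t in Ioo 0 T, eLpNorm (u t) ∞ volume
        ≤ ∫⁻ t in Ioo 0 T, (A t + eLpNorm (fun x => u t x - UnboundedOperators.heatExtension (u 0) t x) ∞ volume) :=
          lintegral_mono_ae ((ae_restrict_mem measurableSet_Ioo).mono htri)
      _ = (∫⁻ t in Ioo 0 T, A t) +
            ∫⁻ t in Ioo 0 T, eLpNorm (fun x => u t x - UnboundedOperators.heatExtension (u 0) t x) ∞ volume :=
          lintegral_add_left' hAm.aemeasurable _
      _ ≤ _ := by rw [hlinA]; exact add_le_add le_rfl hnon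
  refine hsum.trans ?_
  rw [← ENNReal.ofReal_add (by positivity) (by positivity)]
  refine ENNReal.ofReal_le_ofReal ?_
  -- real arithmetic: `4C√(2E)T^{1/4} + KE ≤ (K + 6C)(√E T^{1/4} + E)`
  have hC0 : 0 ≤ (C : ℝ) := NNReal.coe_nonneg _
  have hT4 : 0 ≤ T ^ (1 / 4 : ℝ) := Real.rpow_nonneg hT.le _
  have hsE : 0 ≤ Real.sqrt E := Real.sqrt_nonneg _
  have hs2 : Real.sqrt (2 * E) = Real.sqrt 2 * Real.sqrt E := Real.sqrt_mul (by norm_num) E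
  have hsqrt2 : Real.sqrt 2 ≤ 3 / 2 := by
    rw [Real.sqrt_le_left (by norm_num)]
    norm_num
  have h1 : (C : ℝ) * (4 * T ^ (1 / 4 : ℝ)) * Real.sqrt (2 * E) ≤ 6 * C * (Real.sqrt E * T ^ (1 / 4 : ℝ)) := by
    rw [hs2]
    have hprod : 0 ≤ (C : ℝ) * T ^ (1 / 4 : ℝ) * Real.sqrt E := by positivity
    nlinarith [mul_le_mul_of_nonneg_left hsqrt2 hprod]
  have h2 : 0 ≤ 6 * (C : ℝ) * E := by positivity
  have h3 : 0 ≤ K * (Real.sqrt E * T ^ (1 / 4 : ℝ)) := by positivity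
  nlinarith [h1, h2, h3]

/-! ## The a priori form versus the printed leaf -/

/-- **Prop. 9.1 (printed form, `ν = 1`) from Lemma 8.1 and the a priori form**: Lemma 8.1
(`tao_finite_energy_smooth_energy_bound`, with its constant `C₈`) gives (9.4)–(9.5) with
`E' = 2 max(1, C₈) E` from `∫|u(0)|² ≤ 2E`, and `√E' ≤ 2 max(1,C₈) √E`, so the printed bound holds
with constant `2 max(1, C₈) K`. PROVED. [cite: Tao2011, Prop. 9.1 (proof, §9, (9.4)–(9.6))] -/
theorem tao2011_boundedTotalSpeed_unit_of_apriori (hL : tao_finite_energy_smooth_energy_bound)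
    (h : tao2011_boundedTotalSpeed_apriori_unit) : tao2011_boundedTotalSpeed_unit := by
  obtain ⟨C₈, hC₈top, h81⟩ := hL
  obtain ⟨K, hK, hmain⟩ := h
  set c₈ : ℝ := max 1 C₈.toReal with hc₈def
  have hc₈1 : 1 ≤ c₈ := le_max_left _ _
  have hc₈0 : 0 < c₈ := one_pos.trans_le hc₈1
  have hC₈le : C₈ ≤ ENNReal.ofReal c₈ := by
    rw [← ENNReal.ofReal_toReal hC₈top.ne]
    exact ENNReal.ofReal_le_ofReal (le_max_right _ _)
  refine ⟨2 * c₈ * K, by positivity, ?_⟩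
  intro T hT u p hsol hfe E hE hE₀
  have hfe' : ∃ A : ℝ≥0∞, A < ⊤ ∧ ∀ t ∈ Icc 0 T, ∫⁻ x, ‖u t x‖ₑ ^ 2 ≤ A := by
    obtain ⟨C', hC'⟩ := hfe
    exact ⟨C', ENNReal.coe_lt_top, hC'⟩
  obtain ⟨h81a, h81b⟩ := h81 1 T one_pos hT u p hsol hfe'
  have hkey : C₈ * ∫⁻ x, ‖u 0 x‖ₑ ^ 2 ≤ ENNReal.ofReal (2 * c₈ * E) :=
    calc C₈ * ∫⁻ x, ‖u 0 x‖ₑ ^ 2 ≤ ENNReal.ofReal c₈ * ENNReal.ofReal (2 * E) :=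
          mul_le_mul' hC₈le hE₀
      _ = ENNReal.ofReal (2 * c₈ * E) := by
          rw [← ENNReal.ofReal_mul hc₈0.le]
          congr 1
          ring
  have hE'0 : 0 ≤ 2 * c₈ * E := by positivity
  have hEt : ∀ t ∈ Icc 0 T, ∫⁻ x, ‖u t x‖ₑ ^ 2 ≤ ENNReal.ofReal (2 * (2 * c₈ * E)) := fun t ht =>
    ((h81a t ht).trans hkey).trans (ENNReal.ofReal_le_ofReal (by nlinarith))
  have hD : ENNReal.ofReal 1 *
      ∫⁻ t in Ioo 0 T, ∫⁻ x, ENNReal.ofReal (FluidPDE.frobeniusNormSq (fderiv ℝ (u t) x)) ≤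
      ENNReal.ofReal (2 * c₈ * E) := h81b.trans hkey
  refine (hmain hT hsol hE'0 hEt hD).trans (ENNReal.ofReal_le_ofReal ?_)
  -- `K(√E' T^{1/4} + E') ≤ 2c₈K(√E T^{1/4} + E)` with `E' = 2c₈E`, `√(2c₈) ≤ 2c₈`
  have hT4 : 0 ≤ T ^ (1 / 4 : ℝ) := Real.rpow_nonneg hT.le _
  have hsE : 0 ≤ Real.sqrt E := Real.sqrt_nonneg _
  have hsplit : Real.sqrt (2 * c₈ * E) = Real.sqrt (2 * c₈) * Real.sqrt E := Real.sqrt_mul (by positivity) E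
  have hs : Real.sqrt (2 * c₈) ≤ 2 * c₈ := by
    rw [Real.sqrt_le_left (by positivity)]
    nlinarith
  rw [hsplit]
  have hprod : 0 ≤ K * (Real.sqrt E * T ^ (1 / 4 : ℝ)) := by positivity
  nlinarith [mul_le_mul_of_nonneg_left hs hprod, hE, hK]

/-- Conversely, **the printed leaf implies the a priori form** (the hypotheses of the a priori
form give finite energy with `C' = 2E` and `∫|u(0)|² ≤ 2E`), so the split loses nothing.
PROVED. [cite: Tao2011, Prop. 9.1] -/
theorem tao2011_boundedTotalSpeed_apriori_unit_of_unit (h : tao2011_boundedTotalSpeed_unit) :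
    tao2011_boundedTotalSpeed_apriori_unit := by
  obtain ⟨K, hK, hmain⟩ := h
  refine ⟨K, hK, ?_⟩
  intro T hT u p hsol E hE hEt _hD
  have hfe : ∃ C' : ℝ≥0, ∀ t ∈ Icc 0 T, ∫⁻ x, ‖u t x‖ₑ ^ 2 ≤ C' :=
    ⟨(2 * E).toNNReal, fun t ht => hEt t ht⟩
  exact hmain hT hsol hfe hE (hEt 0 ⟨le_rfl, hT.le⟩)

/-! ## Assemblies -/

/-- **Cor. 11.1 (bounded enstrophy, every `ν > 0`) from Lemma 8.1, the Duhamel-nonlinear speed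
fact and the §10 a priori leaf.** [cite: Tao2011, Cor. 11.1] -/
theorem tao2011_boundedEnstrophy_of_duhamel_leaves (hL : tao_finite_energy_smooth_energy_bound)
    (hN : tao2011_duhamelNonlinearSpeed_unit)
    (hA' : tao2011_enstrophyLocalisation_exterior_apriori_unit) : tao2011_boundedEnstrophy :=
  tao2011_boundedEnstrophy_of_unit_leaves hL
    (tao2011_boundedTotalSpeed_unit_of_apriori hL (tao2011_boundedTotalSpeed_apriori_unit_of_duhamel hN))
    hA'

/-- **Cor. 11.4 (`tao_unconditional_uniqueness`, every `ν > 0`) from Lemma 8.1, the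
Duhamel-nonlinear speed fact and the §10 a priori leaf** (its velocity form and the duplicate
vendoring `tao_finite_energy_velocity_uniqueness` as well; the `B`-side is the tree theorem
`tao2011_velocity_eq_of_memSobolevX_holds`). [cite: Tao2011, Cor. 11.4 (Remark 11.3)] -/
theorem tao_unconditional_uniqueness_of_duhamel_leaves (hL : tao_finite_energy_smooth_energy_bound)
    (hN : tao2011_duhamelNonlinearSpeed_unit)
    (hA' : tao2011_enstrophyLocalisation_exterior_apriori_unit) :
    tao_unconditional_uniqueness ∧ tao_unconditional_uniqueness_velocity ∧
      tao_finite_energy_velocity_uniqueness :=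
  tao_unconditional_uniqueness_of_unit_leaves hL
    (tao2011_boundedTotalSpeed_unit_of_apriori hL (tao2011_boundedTotalSpeed_apriori_unit_of_duhamel hN))
    hA'

end Literature.Analysis.FluidPDE

end
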